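import Summits.CriticalPhenomena.PercolationContinuityZ3.Theorems.SoloInformedAnnulusProduct
import Summits.CriticalPhenomena.PercolationContinuityZ3.Theorems.SoloInformedBoxCrossingFace
import HarnessLib

/-!
# The non-summable-blocking face is an equivalence (solo-informed, session 18)

Sub-problem `Summit.CriticalPhenomena.PercolationContinuityZ3` (`θ(p_c) = 0` on `ℤ³`).
Paper `paper/sharpest-statement.md`, §7 row (Y_Σ) and §7b.3 (d5)(δ); complements
`SoloInformedAnnulusProduct` (`percolationContinuity_of_not_summable_blocking`: ONE strictly
increasing scale sequence with non-summable annulus-blocking probabilities at `p_c` gives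
`θ(p_c) = 0`).

Here the converse: if `θ(p_c) = 0` then `P_{p_c}(Λ(a+1) ↔ ∂ⁱⁿΛ(b) in Λ(b)) → 0` as `b → ∞` for
every `a` (`tendsto_real_boxCrossing_of_continuity`), so a GREEDY scale sequence
(`greedySeq`: the next scale is chosen with annulus-crossing probability `≤ 1/2`) has blocking
probabilities `≥ 1/2`, which are not summable.  Hence

* `percolationContinuity_iff_exists_not_summable_blocking` —
  **`θ(p_c) = 0 ↔ ∃ s strictly increasing, ¬ Summable (blocking p_c s)`**, and its `ℤ³` instance:
  with the scale sequence FREE the product face (Y_Σ) is a restatement of the conjunct (like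
  face 19); its content as a door is only at a FIXED growth rate of the scales (row (Y_k)).

Elementary. [folklore]
-/

noncomputable section

namespace Summit.CriticalPhenomena.PercolationContinuityZ3.Theorems

open MeasureTheory ProbabilityTheory Filter Topology
open Literature.Probability.Percolation Literature.Probability.LatticeModels
open Literature.Probability.Percolation.CerfDembinVanishing
open scoped ENNReal

namespace SurfaceTension

variable {d : ℕ}

/-- In the continuity world every annulus can be widened until it is crossed with probability at
most `1/2`. -/
theorem exists_real_annCross_le_half (hcont : PercolationContinuity d) (a : ℕ) :
    ∃ b, a + 1 < b ∧
      (bondPercolation (zdGraph d) (criticalProbI d)).real (annCross (d := d) a b) ≤ 1 / 2 := by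
  have h := tendsto_real_boxCrossing_of_continuity hcont (a + 1)
  have hev : ∀ᶠ b in atTop,
      (bondPercolation (zdGraph d) (criticalProbI d)).real (boxCrossing d (a + 1) b) ≤ 1 / 2 :=
    h.eventually (ge_mem_nhds (by norm_num : (0 : ℝ) < 1 / 2))
  obtain ⟨b, hb⟩ := (hev.and (eventually_gt_atTop (a + 1))).exists
  exact ⟨b, hb.2, (measureReal_mono (annCross_subset_boxCrossing hb.2.le)).trans hb.1⟩

/-- The greedy scale sequence of the continuity world: `s 0 = 0`, and `s (i+1) > s i + 1` is a
scale at which the annulus `Λ(s (i+1)) ∖ Λ(s i)` is crossed with probability `≤ 1/2`. -/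
def greedySeq (hcont : PercolationContinuity d) : ℕ → ℕ
  | 0 => 0
  | i + 1 => Classical.choose (exists_real_annCross_le_half hcont (greedySeq hcont i))

/-- The defining property of the greedy scale sequence. -/
theorem greedySeq_spec (hcont : PercolationContinuity d) (i : ℕ) :
    greedySeq hcont i + 1 < greedySeq hcont (i + 1) ∧
      (bondPercolation (zdGraph d) (criticalProbI d)).real
        (annCross (d := d) (greedySeq hcont i) (greedySeq hcont (i + 1))) ≤ 1 / 2 :=
  Classical.choose_spec (exists_real_annCross_le_half hcont (greedySeq hcont i))

/-- The greedy scale sequence is strictly increasing. -/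
theorem strictMono_greedySeq (hcont : PercolationContinuity d) : StrictMono (greedySeq hcont) :=
  strictMono_nat_of_lt_succ fun i => by have := (greedySeq_spec hcont i).1; omega

/-- Along the greedy scale sequence every blocking probability is `≥ 1/2`. -/
theorem half_le_blocking_greedySeq (hcont : PercolationContinuity d) (i : ℕ) :
    1 / 2 ≤ blocking (d := d) (criticalProbI d) (greedySeq hcont) i := by
  have := (greedySeq_spec hcont i).2
  unfold blocking
  linarith

/-- **Converse of the product face.** If `θ(p_c) = 0` then some strictly increasing scale
sequence has non-summable blocking probabilities. -/
theorem exists_not_summable_blocking_of_continuity (hcont : PercolationContinuity d) :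
    ∃ s : ℕ → ℕ, StrictMono s ∧ ¬ Summable (blocking (d := d) (criticalProbI d) s) := by
  refine ⟨greedySeq hcont, strictMono_greedySeq hcont, fun hsum => ?_⟩
  have hev := hsum.tendsto_atTop_zero.eventually (gt_mem_nhds (by norm_num : (0 : ℝ) < 1 / 2))
  obtain ⟨i, hi⟩ := hev.exists
  have h2 := half_le_blocking_greedySeq hcont i
  linarith

/-- **Face (Y_Σ) is an equivalence.** `θ(p_c) = 0` on `ℤ^d` iff along SOME strictly increasing
scale sequence the annulus-blocking probabilities at `p_c` are not summable. -/
theorem percolationContinuity_iff_exists_not_summable_blocking :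
    PercolationContinuity d ↔
      ∃ s : ℕ → ℕ, StrictMono s ∧ ¬ Summable (blocking (d := d) (criticalProbI d) s) :=
  ⟨exists_not_summable_blocking_of_continuity,
    fun ⟨_, hs, h⟩ => percolationContinuity_of_not_summable_blocking hs h⟩

/-- The `ℤ³` instance. -/
theorem percolationContinuityZ3_iff_exists_not_summable_blocking :
    PercolationContinuityZ3 ↔
      ∃ s : ℕ → ℕ, StrictMono s ∧ ¬ Summable (blocking (d := 3) (criticalProbI 3) s) :=
  percolationContinuity_iff_exists_not_summable_blocking

end SurfaceTension

end Summit.CriticalPhenomena.PercolationContinuityZ3.Theorems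

end
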